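import Summits.BirchSwinnertonDyer.BirchSwinnertonDyer.Theorems.Rank2Observatory2DescClSplitQ
import Summits.BirchSwinnertonDyer.BirchSwinnertonDyer.Theorems.Rank2Observatory2DescClCurveCertE2Defs
import HarnessLib

/-!
# BirchSwinnertonDyer — rank ≥ 2 observatory: KERNEL-2DESC-CL, SQ2 — THE TWO-VIEW FIELD CORE OVER A TOTALLY SPLIT `q`

HONEST FRAMING: per-curve certified theorems and census instruments; no claim on BSD in rank ≥ 2.

Second generic file of the split-`q` variant (design `…/kernel-2desc-cl/v2/generics/cq/PLAN-g51.md`).  The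
two-view field record `ClFieldCertE` (α-view `base`, second generator `η`, `η`-rows, two-view sweep) is REUSED
as a type; this file supplies the split-`q` reading of its signature-free core, `checkCoreE3` (= `checkCoreE`
with `base.checkReg3` of SQ1 in place of `base.checkReg`; the `η`-certificate, the `η`-registry clause and the
two-view sweep clause are the landed ones VERBATIM), and re-proves its field-level consequences against it:
`d_pos3`, `aeval_eta3`, `irreducibleE3`, `rowE_check_of_mem3`, the code primes `codePrimeR3` (α-rows) and
`codePrimeEta3` (`η`-rows) with their presentations, and the generation theorem
`closure_q_eq_top_of_coreE3` — **the classes of the ideals containing `q` generate `Cl(K)`** — by the landed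
two-view Minkowski sweep (`eq_top_of_classIn_lt_gcd`), a sweep prime being one of the THREE primes above `q`
(`qcover_of_reg3`), an `α`-row prime or an `η`-row prime with a one- or two-view class certificate.
Proof texts are those of `…ClFieldCertE` / `…ClCurveCertE` / `…ClCurveCertE2Defs` with the `W₁/W₂` cover
replaced by the three-prime cover; new declarations only.

Sorry-free; axioms `propext`, `Classical.choice`, `Quot.sound`.
[cite: Cohen1993, §4.8.2, §6.2, §6.5] [cite: Marcus2018, Ch. 5, Thm. 35 and Cor. 2, Thm. 37]
-/

set_option linter.dupNamespace false

noncomputable section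

open scoped Classical NumberField nonZeroDivisors

open Literature.NumberTheory.NumberFields Polynomial Module NumberField IsDedekindDomain Ideal

namespace Summit.BirchSwinnertonDyer.BirchSwinnertonDyer.Rank2Observatory.TwoDescCl

open TwoDescCubic

variable {K : Type*} [Field K] [NumberField K] {θ : K}

/-! ## `α`-row code primes from the split-`q` registry core -/

namespace ClFieldCert

variable {fc : ClFieldCert}

/-- The height-one prime of a code certified present in the `α`-registry (junk `WQ 0` otherwise), split-`q`
reading. -/
def codePrimeR3 (hθ : aeval θ (MonicCubic.poly fc.a fc.b fc.c) = 0) (h3 : finrank ℚ K = 3)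
    (hR : fc.checkReg3 = true) (hpr : fc.primeList.Forall Nat.Prime) (C : PCode) : HeightOneSpectrum (𝓞 K) :=
  if h : (fc.primes.any fun e => e.p == C.1) = true ∧ C ∈ (fc.row C.1).codes then
    primeOfCode (fc.irreducible_of_reg3 hR) hθ h3 (e := fc.row C.1) (fc.prime_of_mem hpr (row_mem h.1).1)
      (fc.row_check_of_mem_reg3 hR (row_mem h.1).1).1 h.2
  else fc.WQ hθ h3 hR hpr 0

/-- A certified code prime is presented by its code. [folklore] -/
theorem codePrimeR3_asIdeal (hθ : aeval θ (MonicCubic.poly fc.a fc.b fc.c) = 0) (h3 : finrank ℚ K = 3)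
    (hR : fc.checkReg3 = true) (hpr : fc.primeList.Forall Nat.Prime) {C : PCode}
    (h₁ : (fc.primes.any fun e => e.p == C.1) = true) (h₂ : C ∈ (fc.row C.1).codes) :
    (codePrimeR3 hθ h3 hR hpr C).asIdeal = idealOf hθ C := by
  rw [codePrimeR3, dif_pos ⟨h₁, h₂⟩]
  rfl

end ClFieldCert

/-! ## The two-view core, split-`q` reading -/

namespace ClFieldCertE

variable (fe : ClFieldCertE)

/-- **The signature-free two-view core over a totally split `q`**: split-`q` registry core of `base` (SQ1),
the `η` certificate, irreducibility of `h`, the `η`-registry, the two-view sweep (the last four verbatim).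
Computable; run once per field by `decide +kernel`. [cite: Cohen1993, §6.5] -/
def checkCoreE3 : Bool :=
  fe.base.checkReg3 && etaCheck fe.base.a fe.base.b fe.base.c fe.u fe.d fe.a' fe.b' fe.c' &&
    noRootMod fe.pIrrE fe.a' fe.b' fe.c' && fe.checkRegistryE && fe.checkSweepE

/-- The split-`q` registry core of `base` holds. -/
theorem checkReg3_of_coreE3 (hE : fe.checkCoreE3 = true) : fe.base.checkReg3 = true := by
  simp only [checkCoreE3, Bool.and_eq_true] at hE
  exact hE.1.1.1.1

/-- The `η` certificate holds. -/
theorem etaCheck_of_coreE3 (hE : fe.checkCoreE3 = true) :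
    etaCheck fe.base.a fe.base.b fe.base.c fe.u fe.d fe.a' fe.b' fe.c' = true := by
  simp only [checkCoreE3, Bool.and_eq_true] at hE
  exact hE.1.1.1.2

/-- `0 < d`. -/
theorem d_pos3 (hE : fe.checkCoreE3 = true) : 0 < fe.d := pos_of_etaCheck (fe.etaCheck_of_coreE3 hE)

/-- **`h(η) = 0`.** [folklore] -/
theorem aeval_eta3 (hθ : aeval θ (MonicCubic.poly fe.base.a fe.base.b fe.base.c) = 0)
    (hE : fe.checkCoreE3 = true) : aeval (eta θ fe.u fe.d) (MonicCubic.poly fe.a' fe.b' fe.c') = 0 :=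
  aeval_eta_eq_zero hθ (fe.etaCheck_of_coreE3 hE)

/-- `h` is irreducible. [folklore] -/
theorem irreducibleE3 (hE : fe.checkCoreE3 = true) : Irreducible (MonicCubic.polyQ fe.a' fe.b' fe.c') := by
  simp only [checkCoreE3, Bool.and_eq_true] at hE
  exact irreducible_of_noRootMod hE.1.1.2

/-- Every `η`-row is checked over `(a′, b′, c′)`, and its prime is not `q`. -/
theorem rowE_check_of_mem3 (hE : fe.checkCoreE3 = true) {e : PrimeEntry} (he : e ∈ fe.primesE) :
    e.check fe.a' fe.b' fe.c' = true ∧ e.p ≠ fe.base.q := by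
  simp only [checkCoreE3, checkRegistryE, Bool.and_eq_true, List.all_eq_true] at hE
  have h := hE.1.2 e he
  exact ⟨h.1, by simpa using h.2⟩

/-- Soundness of a two-view class certificate in the `α`-view. [cite: Cohen1993, §6.5 (relations)] -/
theorem classIn_of_classCheck2_alpha3 (hθ : aeval θ (MonicCubic.poly fe.base.a fe.base.b fe.base.c) = 0)
    (h3 : finrank ℚ K = 3) (hE : fe.checkCoreE3 = true) {e : PrimeEntry} (hp : e.p.Prime)
    (hrow : e.check fe.base.a fe.base.b fe.base.c = true) {C : PCode} (hC : C ∈ e.codes) (hq : fe.base.q.Prime)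
    {ce : (Bool × PCode) × (ℤ × ℤ × ℤ) × (ℤ × ℤ × ℤ) × ℕ} (h : fe.classCheck2 true C ce = true) :
    ClassIn (Subgroup.closure {cc : ClassGroup (𝓞 K) | ∃ (J : Ideal (𝓞 K)) (hJ : J ∈ (Ideal (𝓞 K))⁰),
      ((fe.base.q : ℕ) : 𝓞 K) ∈ J ∧ ClassGroup.mk0 ⟨J, hJ⟩ = cc}) (idealOf hθ C) := by
  simp only [classCheck2, classRel2, cond_true, Bool.and_eq_true, beq_iff_eq, decide_eq_true_eq] at h
  obtain ⟨⟨⟨⟨-, rfl⟩, hb⟩, htv⟩, ⟨hcop, hmem⟩, hN⟩ := h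
  have hirr := fe.base.irreducible_of_reg3 (fe.checkReg3_of_coreE3 hE)
  have hη := fe.aeval_eta3 hθ hE
  have hβ := natCast_mul_twoViewElt_alpha hθ (fe.d_pos3 hE) hη hb htv
  exact classIn_of_rel2 hirr hθ h3 hp hrow hC hq hcop hmem hβ hN

/-- Soundness of a two-view class certificate in the `η`-view. [cite: Cohen1993, §6.5 (relations)] -/
theorem classIn_of_classCheck2_eta3 (hθ : aeval θ (MonicCubic.poly fe.base.a fe.base.b fe.base.c) = 0)
    (h3 : finrank ℚ K = 3) (hE : fe.checkCoreE3 = true) {e : PrimeEntry} (hp : e.p.Prime)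
    (hrow : e.check fe.a' fe.b' fe.c' = true) {C : PCode} (hC : C ∈ e.codes) (hq : fe.base.q.Prime)
    {ce : (Bool × PCode) × (ℤ × ℤ × ℤ) × (ℤ × ℤ × ℤ) × ℕ} (h : fe.classCheck2 false C ce = true) :
    ClassIn (Subgroup.closure {cc : ClassGroup (𝓞 K) | ∃ (J : Ideal (𝓞 K)) (hJ : J ∈ (Ideal (𝓞 K))⁰),
      ((fe.base.q : ℕ) : 𝓞 K) ∈ J ∧ ClassGroup.mk0 ⟨J, hJ⟩ = cc}) (idealOf (fe.aeval_eta3 hθ hE) C) := by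
  simp only [classCheck2, classRel2, cond_false, Bool.and_eq_true, beq_iff_eq, decide_eq_true_eq] at h
  obtain ⟨⟨⟨⟨-, rfl⟩, hb⟩, htv⟩, ⟨hcop, hmem⟩, hN⟩ := h
  have hirr' := fe.irreducibleE3 hE
  have hη := fe.aeval_eta3 hθ hE
  have hβ := natCast_mul_twoViewElt_eta hθ (fe.d_pos3 hE) hη hb htv
  exact classIn_of_rel2 hirr' hη h3 hp hrow hC hq hcop hmem hβ hN

/-- **The classes of the primes above `q` generate the class group** (two-view sweep; a sweep prime equal to
`q` is covered by the three-prime cover of SQ1). [cite: Marcus2018, Ch. 5, Cor. 2 to Thm. 35] [cite: Cohen1993, §6.5] -/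
theorem closure_q_eq_top_of_coreE3 (hθ : aeval θ (MonicCubic.poly fe.base.a fe.base.b fe.base.c) = 0)
    (h3 : finrank ℚ K = 3) (hE : fe.checkCoreE3 = true) (hpr : fe.primeListE.Forall Nat.Prime) :
    Subgroup.closure {cc : ClassGroup (𝓞 K) | ∃ (J : Ideal (𝓞 K)) (hJ : J ∈ (Ideal (𝓞 K))⁰),
      ((fe.base.q : ℕ) : 𝓞 K) ∈ J ∧ ClassGroup.mk0 ⟨J, hJ⟩ = cc} = ⊤ := by
  have hR := fe.checkReg3_of_coreE3 hE
  have hprb := fe.base_primeList hpr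
  have hirr := fe.base.irreducible_of_reg3 hR
  have hirr' := fe.irreducibleE3 hE
  have hη := fe.aeval_eta3 hθ hE
  have hE' := hE
  simp only [checkCoreE3, checkSweepE, Bool.and_eq_true, decide_eq_true_eq, List.all_eq_true, List.mem_range,
    Bool.or_eq_true, beq_iff_eq, List.any_eq_true] at hE'
  obtain ⟨-, ⟨⟨hd, hcov⟩, hcls⟩, hclsE⟩ := hE'
  refine eq_top_of_classIn_lt_gcd hirr hθ hirr' hη h3 (b := fe.base.bM) hd fun p hpb hp P hP hlt => ?_
  have hpP : (p : 𝓞 K) ∈ P := sweep_natCast_mem p hP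
  have hPr : P.IsPrime := hP.1
  rcases hcov p hpb with (((hlt2 | hsf) | rfl) | ⟨e, he, hep⟩) | ⟨e, he, hep⟩
  · exact absurd hp.two_le (by omega)
  · rw [ClFieldCert.smallFactor_eq_false hp] at hsf; exact absurd hsf Bool.false_ne_true
  · obtain ⟨i, h⟩ := fe.base.qcover_of_reg3 hθ h3 hR hprb P hPr hpP
    rw [h]
    exact classIn_tsupp_span_pair_self _ _
  · subst hep
    have hrow := (fe.base.row_check_of_mem_reg3 hR he).1
    have hp' := fe.base.prime_of_mem hprb he
    obtain ⟨C, hC, rfl⟩ := cover_of_check hirr hθ h3 hp' hrow P hPr hpP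
    rcases hcls e he with hb | hall
    · exfalso
      refine not_pow_inertiaDeg_lt (mem_primesOver_of_check hirr hθ h3 hp' hrow hC)
        (absNorm_of_check hirr hθ h3 hp' hrow hC) ?_ hlt
      exact hb.trans (Nat.le_self_pow (ClFieldCert.codeDeg_pos C).ne' _)
    · rcases hall C hC with ⟨dd, -, hcc⟩ | ⟨ce, -, hce⟩
      · exact classIn_of_classCheck hirr hθ h3 hp' hrow hC (fe.base.q_prime hprb) hcc hlt
      · exact fe.classIn_of_classCheck2_alpha3 hθ h3 hE hp' hrow hC (fe.base.q_prime hprb) hce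
  · -- an `η`-row: the same argument in the `η`-view
    subst hep
    have hrow := (fe.rowE_check_of_mem3 hE he).1
    have hp' := fe.prime_of_memE hpr he
    obtain ⟨C, hC, rfl⟩ := cover_of_check hirr' hη h3 hp' hrow P hPr hpP
    rcases hclsE e he with hb | hall
    · exfalso
      refine not_pow_inertiaDeg_lt (mem_primesOver_of_check hirr' hη h3 hp' hrow hC)
        (absNorm_of_check hirr' hη h3 hp' hrow hC) ?_ hlt
      exact hb.trans (Nat.le_self_pow (ClFieldCert.codeDeg_pos C).ne' _)
    · rcases hall C hC with ⟨dd, -, hcc⟩ | ⟨ce, -, hce⟩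
      · exact classIn_of_classCheck hirr' hη h3 hp' hrow hC (fe.base.q_prime hprb) hcc hlt
      · exact fe.classIn_of_classCheck2_eta3 hθ h3 hE hp' hrow hC (fe.base.q_prime hprb) hce

variable {fe}

/-- The height-one prime of a code certified present in the `η`-registry (junk `WQ 0` otherwise), split-`q`
reading. -/
def codePrimeEta3 (hθ : aeval θ (MonicCubic.poly fe.base.a fe.base.b fe.base.c) = 0) (h3 : finrank ℚ K = 3)
    (hE : fe.checkCoreE3 = true) (hpr : fe.primeListE.Forall Nat.Prime) (C : PCode) : HeightOneSpectrum (𝓞 K) :=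
  if h : (fe.primesE.any fun e => e.p == C.1) = true ∧ C ∈ (fe.rowE C.1).codes then
    primeOfCode (fe.irreducibleE3 hE) (fe.aeval_eta3 hθ hE) h3 (e := fe.rowE C.1)
      (fe.prime_of_memE hpr (fe.rowE_mem h.1).1) (fe.rowE_check_of_mem3 hE (fe.rowE_mem h.1).1).1 h.2
  else fe.base.WQ hθ h3 (fe.checkReg3_of_coreE3 hE) (fe.base_primeList hpr) 0

/-- A certified `η`-code prime is presented by its code (in the `η`-view). [folklore] -/
theorem codePrimeEta3_asIdeal (hθ : aeval θ (MonicCubic.poly fe.base.a fe.base.b fe.base.c) = 0)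
    (h3 : finrank ℚ K = 3) (hE : fe.checkCoreE3 = true) (hpr : fe.primeListE.Forall Nat.Prime) {C : PCode}
    (h₁ : (fe.primesE.any fun e => e.p == C.1) = true) (h₂ : C ∈ (fe.rowE C.1).codes) :
    (codePrimeEta3 hθ h3 hE hpr C).asIdeal = idealOf (fe.aeval_eta3 hθ hE) C := by
  rw [codePrimeEta3, dif_pos ⟨h₁, h₂⟩]
  rfl

end ClFieldCertE

end Summit.BirchSwinnertonDyer.BirchSwinnertonDyer.Rank2Observatory.TwoDescCl

end
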